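import Mathlib.Data.Fin.Tuple.Basic
import Mathlib.Data.Fin.VecNotation
import Mathlib.Logic.Equiv.Fin.Basic
import Literature.Computability.Complexity.SymmetricCircuit
import Literature.Computability.Complexity.CircuitDAG
import HarnessLib

/-!
# Symmetric threshold circuits for ordered colour refinement and the canonical form, I: the DAG

Anderson–Dawar (2017, Thm 1 with §3) show that every formula of fixed-point logic with counting
translates into a polynomial-size SYMMETRIC threshold circuit, and colour refinement — indeed the
canonical labelling of graphs with a discrete stable colouring (Immerman–Lander 1990, Thm 1.9.4)
— is the textbook example of such a formula. This file writes that particular symmetric circuit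
down explicitly, on the tree's labelled DAGs (`GateDAG`, `CircuitDAG.lean`), for `m`-vertex graphs
read off `m × m` Boolean matrices (`Gr x = SimpleGraph.fromRel (x · · = true)`):

* gates `eq t u v` / `lt t u v` (`t ≤ T`) — "`u` and `v` have the same / a smaller colour after
  `t` rounds of ORDERED colour refinement" (`Literature.Combinatorics.SimpleGraph.ocr`), built
  round by round from neighbour-count comparisons `cge t u v w` (a single MAJORITY gate over the
  `m` wires "`w'` is a neighbour of `u` in the class of `w`" and the `m` negated wires for `v`
  decides `#N(u) ∩ [w] ≥ #N(v) ∩ [w]`), their conjunctions and the lexicographic clause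
  `lex t u v`;
* gates `rk u i` — "the canonical rank of `u` (number of vertices of smaller final colour) is
  `i`" (two majority gates with constant padding), and the OUTPUT family `y i j` — "the vertices
  of ranks `i` and `j` are adjacent": the adjacency matrix of the canonical form
  (`Literature.Combinatorics.SimpleGraph.canonGraph`).

Here: the gate type `SymCR.Node m T`, gate functions (all in `tcBasis`), wiring, acyclicity
(`SymCR.level`), the vertex-renaming action `SymCR.Node.act` and the DAG `SymCR.crDAG m T o`
with output `y o.1 o.2`. Size (`≤ 22·(m+1)⁴·(T+1)` gates) and SYMMETRY (every vertex
permutation, acting diagonally on the inputs and by `act` on the gates, is an automorphism) are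
in `SymmetricColourRefinementSymmetry.lean`; the semantics (the gates compute what their names
say) in `SymmetricColourRefinementSemantics.lean`.

## References

* [AndersonDawar2016] M. Anderson, A. Dawar, *On symmetric circuits and fixed-point logics*,
  Theory Comput. Syst. 60 (2017), Thm 1, §3 (FPC ⊆ P-uniform symmetric threshold circuits).
* [ImmermanLander1990] N. Immerman, E. Lander, *Describing graphs: a first-order approach to graph
  canonization* (1990), §1.9, Thm 1.9.4 (canonical labelling from the stable colouring).
* [CaiFurerImmerman1992] Cai–Fürer–Immerman, Combinatorica 12 (1992), §5 (vertex refinement).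
-/

namespace Literature.Computability.Complexity

open Finset

namespace SymCR

/-! ### Gate indices -/

set_option synthInstance.maxSize 2048 in
set_option synthInstance.maxHeartbeats 400000 in
/-- Gate indices of the colour-refinement canonisation circuit on `m` vertices with `T` rounds
(see the module docstring for the meaning of each family; `t` indexes rounds, `u v w w'`
vertices, `i j` RANKS). [cite: AndersonDawar2016, §3 (FPC to symmetric circuits)] -/
inductive Node (m T : ℕ)
  | tt
  | ff
  | e (u v : Fin m)
  | adj (u v : Fin m)
  | eq (t : Fin (T + 1)) (u v : Fin m)
  | lt (t : Fin (T + 1)) (u v : Fin m)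
  | ae (t : Fin T) (u w' w : Fin m)
  | nae (t : Fin T) (u w' w : Fin m)
  | cge (t : Fin T) (u v w : Fin m)
  | ceq (t : Fin T) (u v w : Fin m)
  | clt (t : Fin T) (u v w : Fin m)
  | nlt (t : Fin T) (w' w : Fin m)
  | imp (t : Fin T) (u v w w' : Fin m)
  | allb (t : Fin T) (u v w : Fin m)
  | lexw (t : Fin T) (u v w : Fin m)
  | lex (t : Fin T) (u v : Fin m)
  | lt2 (t : Fin T) (u v : Fin m)
  | rge (u : Fin m) (i : Fin (m + 1))
  | nrge (u : Fin m) (i : Fin (m + 1))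
  | rk (u : Fin m) (i : Fin m)
  | yt (i j u v : Fin m)
  | y (i j : Fin m)
  deriving DecidableEq, Fintype

namespace Node

variable {m T : ℕ}

/-- Gate functions: constants `∧₀`/`∨₀`, connectives `∧ₖ`, `∨ₖ`, `¬`, and majority `MAJ_{2m}`
for the two counting families. [folklore] -/
def fn : Node m T → GateFn
  | tt => GateFn.and 0
  | ff => GateFn.or 0
  | e _ _ => GateFn.or 2
  | adj _ _ => GateFn.and 2
  | eq _ _ _ => GateFn.and (m + 1)
  | lt _ _ _ => GateFn.or 2
  | ae _ _ _ _ => GateFn.and 2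
  | nae _ _ _ _ => GateFn.not
  | cge _ _ _ _ => GateFn.maj (m + m)
  | ceq _ _ _ _ => GateFn.and 2
  | clt _ _ _ _ => GateFn.not
  | nlt _ _ _ => GateFn.not
  | imp _ _ _ _ _ => GateFn.or 2
  | allb _ _ _ _ => GateFn.and m
  | lexw _ _ _ _ => GateFn.and 2
  | lex _ _ _ => GateFn.or m
  | lt2 _ _ _ => GateFn.and 2
  | rge _ _ => GateFn.maj (m + m)
  | nrge _ _ => GateFn.not
  | rk _ _ => GateFn.and 2
  | yt _ _ _ _ => GateFn.and 3
  | y _ _ => GateFn.or (m * m)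

/-- The wires: matrix entries or gates. [folklore] -/
abbrev W (m T : ℕ) : Type := (Fin m × Fin m) ⊕ Node m T

/-- Argument wires of every gate (see the module docstring). [cite: AndersonDawar2016, §3 (FPC to symmetric circuits)] -/
def args : (l : Node m T) → Fin (fn l).1 → W m T
  | tt => Fin.elim0
  | ff => Fin.elim0
  | e u v => fun a => if (a : ℕ) = 0 then Sum.inl (u, v) else Sum.inl (v, u)
  | adj u v => fun a => if (a : ℕ) = 0 then Sum.inr (e u v) else
      (if u = v then Sum.inr ff else Sum.inr tt)
  | eq ⟨0, _⟩ _ _ => fun _ => Sum.inr tt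
  | eq ⟨t + 1, h⟩ u v =>
      Fin.cons (Sum.inr (eq ⟨t, by omega⟩ u v)) fun k => Sum.inr (ceq ⟨t, by omega⟩ u v k)
  | lt ⟨0, _⟩ _ _ => fun _ => Sum.inr ff
  | lt ⟨t + 1, h⟩ u v => fun a =>
      if (a : ℕ) = 0 then Sum.inr (lt ⟨t, by omega⟩ u v) else Sum.inr (lt2 ⟨t, by omega⟩ u v)
  | ae t u w' w => fun a => if (a : ℕ) = 0 then Sum.inr (adj u w') else Sum.inr (eq t.castSucc w' w)
  | nae t u w' w => fun _ => Sum.inr (ae t u w' w)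
  | cge t u v w =>
      Fin.append (fun w' => Sum.inr (ae t u w' w)) (fun w' => Sum.inr (nae t v w' w))
  | ceq t u v w => fun a => if (a : ℕ) = 0 then Sum.inr (cge t u v w) else Sum.inr (cge t v u w)
  | clt t u v w => fun _ => Sum.inr (cge t u v w)
  | nlt t w' w => fun _ => Sum.inr (lt t.castSucc w' w)
  | imp t u v w w' => fun a => if (a : ℕ) = 0 then Sum.inr (nlt t w' w) else Sum.inr (ceq t u v w')
  | allb t u v w => fun w' => Sum.inr (imp t u v w w')
  | lexw t u v w => fun a => if (a : ℕ) = 0 then Sum.inr (clt t u v w) else Sum.inr (allb t u v w)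
  | lex t u v => fun w => Sum.inr (lexw t u v w)
  | lt2 t u v => fun a => if (a : ℕ) = 0 then Sum.inr (eq t.castSucc u v) else Sum.inr (lex t u v)
  | rge u i =>
      Fin.append (fun v => Sum.inr (lt (Fin.last T) v u))
        (fun k : Fin m => if (k : ℕ) + i < m then Sum.inr tt else Sum.inr ff)
  | nrge u i => fun _ => Sum.inr (rge u i)
  | rk u i => fun a => if (a : ℕ) = 0 then Sum.inr (rge u i.castSucc) else Sum.inr (nrge u i.succ)
  | yt i j u v => fun a => if (a : ℕ) = 0 then Sum.inr (rk u i) else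
      (if (a : ℕ) = 1 then Sum.inr (rk v j) else Sum.inr (adj u v))
  | y i j => fun p => Sum.inr (yt i j (finProdFinEquiv.symm p).1 (finProdFinEquiv.symm p).2)

/-- A level function increasing along the wires (ten levels per round). [folklore] -/
def level : Node m T → ℕ
  | tt => 0
  | ff => 0
  | e _ _ => 0
  | adj _ _ => 1
  | eq t _ _ => 10 * t + 2
  | lt t _ _ => 10 * t + 2
  | ae t _ _ _ => 10 * t + 3
  | nae t _ _ _ => 10 * t + 4
  | cge t _ _ _ => 10 * t + 5
  | ceq t _ _ _ => 10 * t + 6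
  | clt t _ _ _ => 10 * t + 6
  | nlt t _ _ => 10 * t + 3
  | imp t _ _ _ _ => 10 * t + 7
  | allb t _ _ _ => 10 * t + 8
  | lexw t _ _ _ => 10 * t + 9
  | lex t _ _ => 10 * t + 10
  | lt2 t _ _ => 10 * t + 11
  | rge _ _ => 10 * T + 3
  | nrge _ _ => 10 * T + 4
  | rk _ _ => 10 * T + 5
  | yt _ _ _ _ => 10 * T + 6
  | y _ _ => 10 * T + 7

/-- Wires point to gates of smaller level (acyclicity). [folklore] -/
theorem level_lt_of_args {l l' : Node m T} {a : Fin (fn l).1} (h : args l a = Sum.inr l') :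
    level l' < level l := by
  cases l with
  | tt => exact a.elim0
  | ff => exact a.elim0
  | e u v => (simp only [args] at h; split_ifs at h)
  | adj u v => simp only [args] at h; split_ifs at h <;> cases h <;> simp [level]
  | eq t u v =>
    rcases t with ⟨_ | t, ht⟩
    · simp only [args] at h; cases h; simp [level]
    · change Fin (m + 1) at a
      revert h
      refine Fin.cases ?_ (fun k => ?_) a
      · intro h
        simp only [args, Fin.cons_zero, Sum.inr.injEq] at h
        subst h; simp [level]
      · intro h
        simp only [args, Fin.cons_succ, Sum.inr.injEq] at h
        subst h; simp [level]; omega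
  | lt t u v =>
    rcases t with ⟨_ | t, ht⟩
    · simp only [args] at h; cases h; simp [level]
    · simp only [args] at h
      split_ifs at h <;> cases h
      · simp [level]
      · simp [level]; omega
  | ae t u w' w => simp only [args] at h; split_ifs at h <;> cases h <;> simp [level]
  | nae t u w' w => simp only [args] at h; cases h; simp [level]
  | cge t u v w =>
    change Fin (m + m) at a
    simp only [args] at h
    induction a using Fin.addCases with
    | left i => rw [Fin.append_left] at h; cases h; simp [level]
    | right i => rw [Fin.append_right] at h; cases h; simp [level]
  | ceq t u v w => simp only [args] at h; split_ifs at h <;> cases h <;> simp [level]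
  | clt t u v w => simp only [args] at h; cases h; simp [level]
  | nlt t w' w => simp only [args] at h; cases h; simp [level]
  | imp t u v w w' => simp only [args] at h; split_ifs at h <;> cases h <;> simp [level]
  | allb t u v w => simp only [args] at h; cases h; simp [level]
  | lexw t u v w => simp only [args] at h; split_ifs at h <;> cases h <;> simp [level]
  | lex t u v => simp only [args] at h; cases h; simp [level]
  | lt2 t u v => simp only [args] at h; split_ifs at h <;> cases h <;> simp [level]
  | rge u i =>
    change Fin (m + m) at a
    simp only [args] at h
    induction a using Fin.addCases with
    | left v => rw [Fin.append_left] at h; cases h; simp [level]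
    | right k =>
      rw [Fin.append_right] at h
      split_ifs at h <;> cases h <;> simp [level]
  | nrge u i => simp only [args] at h; cases h; simp [level]
  | rk u i => simp only [args] at h; split_ifs at h <;> cases h <;> simp [level]
  | yt i j u v => simp only [args] at h; split_ifs at h <;> cases h <;> simp [level]
  | y i j => simp only [args] at h; cases h; simp [level]

/-- All gate functions lie in the threshold basis. [folklore] -/
theorem fn_mem_tcBasis (l : Node m T) : fn l ∈ tcBasis := by
  cases l <;>
    first
    | exact acBasis_subset_tcBasis (Or.inl rfl)
    | exact acBasis_subset_tcBasis (Or.inr (Set.mem_iUnion.2 ⟨_, Or.inl rfl⟩))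
    | exact acBasis_subset_tcBasis (Or.inr (Set.mem_iUnion.2 ⟨_, Or.inr rfl⟩))
    | exact Or.inr (Set.mem_iUnion.2 ⟨_, rfl⟩)

/-- All gate functions are symmetric Boolean functions. [folklore] -/
theorem fn_isSymmetric (l : Node m T) : (fn l).IsSymmetric :=
  isSymmetric_of_mem_tcBasis (fn_mem_tcBasis l)

/-! ### The action of vertex permutations on gates -/

/-- A vertex permutation renames the VERTEX parameters of a gate (round and rank parameters are
fixed). [cite: AndersonDawar2016, Def. 6 (induced automorphism)] -/
def act (ρ : Equiv.Perm (Fin m)) : Node m T → Node m T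
  | tt => tt
  | ff => ff
  | e u v => e (ρ u) (ρ v)
  | adj u v => adj (ρ u) (ρ v)
  | eq t u v => eq t (ρ u) (ρ v)
  | lt t u v => lt t (ρ u) (ρ v)
  | ae t u w' w => ae t (ρ u) (ρ w') (ρ w)
  | nae t u w' w => nae t (ρ u) (ρ w') (ρ w)
  | cge t u v w => cge t (ρ u) (ρ v) (ρ w)
  | ceq t u v w => ceq t (ρ u) (ρ v) (ρ w)
  | clt t u v w => clt t (ρ u) (ρ v) (ρ w)
  | nlt t w' w => nlt t (ρ w') (ρ w)
  | imp t u v w w' => imp t (ρ u) (ρ v) (ρ w) (ρ w')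
  | allb t u v w => allb t (ρ u) (ρ v) (ρ w)
  | lexw t u v w => lexw t (ρ u) (ρ v) (ρ w)
  | lex t u v => lex t (ρ u) (ρ v)
  | lt2 t u v => lt2 t (ρ u) (ρ v)
  | rge u i => rge (ρ u) i
  | nrge u i => nrge (ρ u) i
  | rk u i => rk (ρ u) i
  | yt i j u v => yt i j (ρ u) (ρ v)
  | y i j => y i j

/-- `act ρ⁻¹` inverts `act ρ`. [folklore] -/
theorem act_symm_act (ρ : Equiv.Perm (Fin m)) (l : Node m T) : act ρ.symm (act ρ l) = l := by
  cases l <;> simp [act]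

/-- The action as a permutation of the gate indices. [folklore] -/
def actEquiv (ρ : Equiv.Perm (Fin m)) : Node m T ≃ Node m T where
  toFun := act ρ
  invFun := act ρ.symm
  left_inv := act_symm_act ρ
  right_inv l := by simpa using act_symm_act ρ.symm l

/-- `actEquiv` is `act`. [folklore] -/
@[simp] theorem actEquiv_apply (ρ : Equiv.Perm (Fin m)) (l : Node m T) : actEquiv ρ l = act ρ l :=
  rfl

end Node

/-! ### The DAG -/

open Node

variable {m T : ℕ}

/-- **The colour-refinement canonisation circuit as a DAG** on the gate type `Node m T`, with
output the canonical-adjacency gate `y o.1 o.2`. [cite: AndersonDawar2016, Thm 1 (FPC to symmetric circuits)] -/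
noncomputable def crDAG (m T : ℕ) (o : Fin m × Fin m) : GateDAG (Fin m × Fin m) (Node m T) where
  fn := Node.fn
  args := Node.args
  out := Sum.inr (Node.y o.1 o.2)
  wf := Subrelation.wf (fun ⟨_, h⟩ => level_lt_of_args h) (InvImage.wf level Nat.lt_wfRel.wf)

/-- The gate functions of the DAG. [folklore] -/
theorem crDAG_fn (o : Fin m × Fin m) (l : Node m T) : (crDAG m T o).fn l = Node.fn l := rfl

/-- The wiring of the DAG. [folklore] -/
theorem crDAG_args (o : Fin m × Fin m) (l : Node m T) : (crDAG m T o).args l = Node.args l := rfl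

/-- The output of the DAG. [folklore] -/
theorem crDAG_out (o : Fin m × Fin m) : (crDAG m T o).out = Sum.inr (Node.y o.1 o.2) := rfl

/-- All gate functions lie in `tcBasis`. [folklore] -/
theorem crDAG_fn_mem_tcBasis (o : Fin m × Fin m) (l : Node m T) : (crDAG m T o).fn l ∈ tcBasis :=
  fn_mem_tcBasis l

/-- All gate functions are symmetric. [folklore] -/
theorem crDAG_fn_isSymmetric (o : Fin m × Fin m) (l : Node m T) : ((crDAG m T o).fn l).IsSymmetric :=
  fn_isSymmetric l

end SymCR

end Literature.Computability.Complexity
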